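import Mathlib
import Summits.Ventures.PercRepro2.ThreeTermPinnedAbstract

/-!
# Three-terminal parts, VI d₄: the kernel check of the symmetrised kernel on every guarded labeling
with first labels `2, 1`
(blind cell PercRepro2, night-3 g31, 2026-08-30; `proofs/NIGHT3-CERT.md` §40.7)

One slice of the check (the labelings `lab' 2 1 f2 f3 f4 f5`: the point `o` heads a neither-cluster,
`b` with label `1`): for every guarded labeling and every sorted triple of representative patterns, the
symmetrised kernel `symKBS` of the abstract states is nonnegative — one kernel `decide` over
`5 · 6 · 7 · 8 = 1,680` label tuples, the guard pruning to the canonical ones.  Own work; standard axioms.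
-/

namespace Summit.Ventures.PercRepro2

open ThreeTerm TypedStar CovForm CovForm.OneTyped

namespace Part

set_option maxHeartbeats 4000000 in
set_option maxRecDepth 100000 in
/-- **The symmetrised kernel is nonnegative on every guarded labeling with first labels `2, 1`.** -/
theorem pinsym_2_1 : ∀ (f2 : Fin 5) (f3 : Fin 6) (f4 : Fin 7) (f5 : Fin 8),
    Guard (lab' 2 1 f2 f3 f4 f5) = true → check5 (states5 (lab' 2 1 f2 f3 f4 f5)) = true := by
  decide +kernel

end Part

end Summit.Ventures.PercRepro2
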